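import Summits.BirchSwinnertonDyer.BirchSwinnertonDyer.Theorems.Rank2ObservatoryCertificate
import Summits.BirchSwinnertonDyer.BirchSwinnertonDyer.Theorems.Rank2ObservatoryPointCount
import HarnessLib

/-!
# BirchSwinnertonDyer — rank ≥ 2 observatory: the curve `389a1` (rank 2)

HONEST FRAMING: per-curve certified theorems and census instruments; no claim on BSD in rank ≥ 2.

Per-curve file of the observatory for Cremona's curve **389a1**, `y² + y = x³ + x² − 2x`
(`[a₁,a₂,a₃,a₄,a₆] = [0,1,1,−2,0]`, `N = 389`, the rank-2 curve of smallest conductor). It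
instantiates `analyticRank_eq_mordellWeilRank_of_rank2Certificate`
(`Rank2ObservatoryCertificate.lean`) with this curve's certificate inputs as NAMED HYPOTHESES
(`hlow`, `hup`, `hL2` = certificate fields `rank_lower`, `rank_upper`, `L2`, plus the tree's
Gross–Zagier–Kolyvagin fact `hGZK`), and
checks IN THE KERNEL what Lean can check today: the discriminant (`Δ = 389`), that the model is an
elliptic curve, that the two listed generators lie on the curve (as `Nonsingular` points of Mathlib's
affine curve), and the point counts `#Ẽ(𝔽_p)` at the torsion-bound and witness primes (`decide`,
via `affinePointCount`). Everything below the line "DATA" is recorded provenance, not a theorem.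

DATA (two-engine record `certs/rank2/389a1.json`, schema `bsdr2-rank2-twoengine/v1`,
sha256 `a75b2b6f26e806a67b2314a18543293ab2c4f844f7d0b5b8c8c5500f613088c9`; engine P = cell seat
cert-1, PARI/GP + python-flint/Arb, certificate sha256 `336d2b91…e8cf1831`, farm job `j063818`;
engine B = cell seat cert-3, Python standard library only (integer interval arithmetic), certificate
sha256 `39f85505…e8435238`, farm job `j063920`; the two engines share no library):
* conductor `389` (P: Tate's algorithm `ellglobalred`; B: table value, functional equation verified to
  `2⁻¹⁰⁷`); root number `w = +1` (P: `ellrootno`; B: theta-series functional-equation test);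
* `L(E,1) = 0` EXACTLY (P: the plus modular symbol `x⁺({0,∞}) = L(E,1)/Ω⁺ = 0`, PARI `msfromell`;
  also Kolyvagin–Kato from an exactly non-torsion point; B reproduces the threshold inequality and the
  point arithmetic); `L'(E,1) = 0` by `w = +1`;
* `L''(E,1)/2! ∈ [0.7593165002884267702301926 ± 7.90·10⁻²⁷]` (P, Arb, `Λ`-series with `M` terms and
  a rigorous tail bound) and `∈ 0.75931650028842677023019260789472 ± 1.2·10⁻³¹` (B, integer
  intervals, independently computed `a_p`); the balls intersect and exclude `0` (101 agreeing bits);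
  Cremona 1997 Table 4: `L''(E,1) ≈ 1.5186`;
* generators `P₁ = (0,0)`, `P₂ = (1,0)` (Cremona `allgens`); `E(ℚ)_tors = 0` (`gcd_l #Ẽ(𝔽_l) = 1`
  over good odd `l ≤ 60`, both engines; kernel: `#Ẽ(𝔽₃) = 6`, `#Ẽ(𝔽₅) = 9` already give `gcd = 3`
  … with `#Ẽ(𝔽₇) = 13` the gcd is `1`); independence mod torsion: the images of `P₁, P₂, P₁+P₂` in
  `Ẽ(𝔽₁₁)` (order `16`) lie outside `2Ẽ(𝔽₁₁)` (P, all three combinations at `q = 11`; B: `q = 3, 11, 3`),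
  each engine's witnesses re-verified by the other's arithmetic in the AGREEMENT step;
* `rank E(ℚ) ≤ 2`: PARI `ellrank(E) = [2, 2, 0, …]` (2-descent, engine P) and Cremona's `mwrank` (table);
  engine B does not compute an upper bound (hypothesis `RANK_UPPER_EXTERNAL`);
* periods: `Ω = 2.4902125608550550753213…` (P `[… ± 2.09·10⁻²⁵]`, B `± 2·10⁻³⁰`, AGM two ways).
A disagreement between the engines on any field would have made this a RED row for the referee and no
file would exist (anomaly protocol); the record is GREEN on all rows.

References: J. E. Cremona, *Algorithms for Modular Elliptic Curves* (2nd ed. 1997), Table 1 (curve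
389A1: rank 2, generators) and §2.13; the certificate theorems of `Rank2ObservatoryCertificate.lean`.
-/

-- single-conjunct summit: `Summit.BirchSwinnertonDyer.BirchSwinnertonDyer.…` repeats the name by design
set_option linter.dupNamespace false

noncomputable section

open scoped Classical

namespace Summit.BirchSwinnertonDyer.BirchSwinnertonDyer.Rank2Observatory

open Literature.NumberTheory.EllipticCurves WeierstrassCurve

namespace Curve389a1

/-- Cremona's curve `389a1`: the (reduced minimal) model `y² + y = x³ + x² − 2x`,
`[a₁,a₂,a₃,a₄,a₆] = [0,1,1,−2,0]` (Cremona 1997, Table 1, N = 389).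
[cite: CremonaAlgorithms1997, Table 1 (389A1)] -/
def E : WeierstrassCurve ℚ := ⟨0, 1, 1, -2, 0⟩

/-- `Δ(389a1) = 389` (kernel arithmetic; Cremona 1997, Table 1). [cite: CremonaAlgorithms1997, Table 1 (389A1)] -/
theorem Δ_eq : E.Δ = 389 := by
  norm_num [E, WeierstrassCurve.Δ, WeierstrassCurve.b₂, WeierstrassCurve.b₄, WeierstrassCurve.b₆,
    WeierstrassCurve.b₈]

/-- `389a1` is an elliptic curve (`Δ = 389 ≠ 0`). [folklore] -/
instance isElliptic : E.IsElliptic := ⟨by rw [Δ_eq]; norm_num⟩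

/-- The affine equation of `389a1`: `y² + y = x³ + x² − 2x`. [cite: CremonaAlgorithms1997, Table 1 (389A1)] -/
theorem equation_iff (x y : ℚ) : E.toAffine.Equation x y ↔ y ^ 2 + y = x ^ 3 + x ^ 2 - 2 * x := by
  rw [WeierstrassCurve.Affine.equation_iff]
  simp only [E]
  constructor <;> intro h <;> linear_combination h

/-- The first listed generator `P₁ = (0, 0)` lies on `389a1` (kernel check of the certificate field
`rank_lower.points[0]`; Cremona `allgens`). [cite: CremonaAlgorithms1997, Table 1 (389A1)] -/
theorem nonsingular_P₁ : E.toAffine.Nonsingular 0 0 :=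
  (WeierstrassCurve.Affine.equation_iff_nonsingular.mp ((equation_iff 0 0).mpr (by norm_num)))

/-- The second listed generator `P₂ = (1, 0)` lies on `389a1` (kernel check of the certificate field
`rank_lower.points[1]`; Cremona `allgens`). [cite: CremonaAlgorithms1997, Table 1 (389A1)] -/
theorem nonsingular_P₂ : E.toAffine.Nonsingular 1 0 :=
  (WeierstrassCurve.Affine.equation_iff_nonsingular.mp ((equation_iff 1 0).mpr (by norm_num)))

/-- The generator `P₁ = (0,0)` as a point of `E(ℚ)`. [cite: CremonaAlgorithms1997, Table 1 (389A1)] -/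
def P₁ : E.toAffine.Point := .some (h := nonsingular_P₁)

/-- The generator `P₂ = (1,0)` as a point of `E(ℚ)`. [cite: CremonaAlgorithms1997, Table 1 (389A1)] -/
def P₂ : E.toAffine.Point := .some (h := nonsingular_P₂)

/-! ### Kernel re-count of `#Ẽ(𝔽_p)` at the certificate's torsion-bound and witness primes -/

/-- `#Ẽ(𝔽₃) = 6` (`a₃ = −2`): both engines; kernel. [folklore] -/
theorem card_F3 : affinePointCount 3 0 1 1 (-2) 0 + 1 = 6 := by decide +kernel

/-- `#Ẽ(𝔽₅) = 9` (`a₅ = −3`): both engines; kernel. [folklore] -/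
theorem card_F5 : affinePointCount 5 0 1 1 (-2) 0 + 1 = 9 := by decide +kernel

/-- `#Ẽ(𝔽₇) = 13` (`a₇ = −5`): both engines; kernel. With `#Ẽ(𝔽₃) = 6` this gives
`gcd = 1`, so `E(ℚ)_tors = 0` granted `TORSION_INJECTS` (reduction is injective on prime-to-`l`
torsion at a good prime `l`; Silverman AEC VII.3.1). [folklore] -/
theorem card_F7 : affinePointCount 7 0 1 1 (-2) 0 + 1 = 13 := by decide +kernel

/-- `gcd(#Ẽ(𝔽₃), #Ẽ(𝔽₇)) = gcd(6, 13) = 1`: the certificate's torsion bound is `1`. [folklore] -/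
theorem torsionBound_eq_one : Nat.gcd 6 13 = 1 := by decide

/-- `#Ẽ(𝔽₁₁) = 16` (`a₁₁ = −4`): the independence-witness prime of both engines; kernel. [folklore] -/
theorem card_F11 : affinePointCount 11 0 1 1 (-2) 0 + 1 = 16 := by decide +kernel

/-! ### The per-curve theorem: certificate fields as named hypotheses

* `hlow : 2 ≤ rank_ℤ E(ℚ)` — certificate field `rank_lower`: the listed generators `(0,0), (1,0)` are
  independent modulo torsion (images of the three non-trivial `𝔽₂`-combinations in `Ẽ(𝔽₁₁)`, of
  order `16`, lie outside `2Ẽ(𝔽₁₁)`; two engines, each re-verifying the other's witnesses). A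
  hypothesis: Mathlib has no reduction map `E(ℚ) → Ẽ(𝔽_q)` yet.
* `hup : rank_ℤ E(ℚ) ≤ 2` — certificate field `rank_upper`: 2-descent, PARI `ellrank(E) = [2, 2, 0, …]`
  (engine P, `PARI_ELLRANK_2DESCENT`) and Cremona's `mwrank` (table); engine B computes no upper bound.
* `hL2 : L''(E,1) ≠ 0` — certificate field `L2`: the two certified balls above, both excluding `0`.
* `hGZK` — Gross–Zagier–Kolyvagin, the tree's named fact (bsd.S17). -/

/-- **`389a1`: `rank_ℤ E(ℚ) = 2`** from the certificate's two rank fields (hypotheses `hlow`, `hup`).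
[cite: CremonaAlgorithms1997, Table 1 (389A1)] -/
theorem mordellWeilRank_eq_two (hlow : 2 ≤ E.mordellWeilRank) (hup : E.mordellWeilRank ≤ 2) :
    E.mordellWeilRank = 2 :=
  le_antisymm hup hlow

/-- **`389a1`: `r_an(E) = rank_ℤ E(ℚ)`** — the per-curve certificate theorem: Gross–Zagier–Kolyvagin
(`hGZK`, the tree's named fact bsd.S17) and the three certificate fields `rank_lower` (`hlow`),
`rank_upper` (`hup`), `L2` (`hL2 : L''(E,1) ≠ 0`, `L''(E,1)/2! ∈ [0.7593165002884267702301926 ±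
7.90·10⁻²⁷] ∩ (0.75931650028842677023019260789472 ± 1.2·10⁻³¹)`, two engines) give the equality via
`analyticRank_eq_mordellWeilRank_of_rank2Certificate`.
[cite: CremonaAlgorithms1997, §2.13, Table 1 (389A1) and Table 4] -/
theorem analyticRank_eq_mordellWeilRank (hGZK : rank_eq_analyticRank_of_analyticRank_le_one)
    (hlow : 2 ≤ E.mordellWeilRank) (hup : E.mordellWeilRank ≤ 2)
    (hL2 : iteratedDeriv 2 E.entireLFunction 1 ≠ 0) :
    E.analyticRank = E.mordellWeilRank :=
  analyticRank_eq_mordellWeilRank_of_rank2Certificate E hGZK hlow hup hL2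

/-- **`389a1`: `r_an(E) = 2`** under the same hypotheses. [cite: CremonaAlgorithms1997, §2.13 and Table 4] -/
theorem analyticRank_eq_two (hGZK : rank_eq_analyticRank_of_analyticRank_le_one)
    (hlow : 2 ≤ E.mordellWeilRank) (hup : E.mordellWeilRank ≤ 2)
    (hL2 : iteratedDeriv 2 E.entireLFunction 1 ≠ 0) : E.analyticRank = 2 := by
  rw [analyticRank_eq_mordellWeilRank hGZK hlow hup hL2, mordellWeilRank_eq_two hlow hup]

end Curve389a1

/-- **`analyticRank_eq_rank_389a1`** — the observatory's per-curve kernel fact for `389a1` under its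
named certificate hypotheses (two-engine record sha256 `a75b2b6f…13088c9`).
[cite: CremonaAlgorithms1997, §2.13 and Table 1 (389A1)] -/
theorem analyticRank_eq_rank_389a1 (hGZK : rank_eq_analyticRank_of_analyticRank_le_one)
    (hlow : 2 ≤ Curve389a1.E.mordellWeilRank) (hup : Curve389a1.E.mordellWeilRank ≤ 2)
    (hL2 : iteratedDeriv 2 Curve389a1.E.entireLFunction 1 ≠ 0) :
    Curve389a1.E.analyticRank = Curve389a1.E.mordellWeilRank :=
  Curve389a1.analyticRank_eq_mordellWeilRank hGZK hlow hup hL2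

end Summit.BirchSwinnertonDyer.BirchSwinnertonDyer.Rank2Observatory

end
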